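import Mathlib
import HarnessLib
import Summits.Ventures.LatticeQCDFlow.Exactness.SphereActionVariance
import Summits.Ventures.LatticeQCDFlow.Exactness.SphereLuscherConstantsParity

/-!
# Third-order lattice sums under the uniform product measure: site-odd functionals integrate to zero, and `∫⟪x_n, U_nm x_m⟫·‖J_k‖² dπ̄ = 2·tr(U_kn U_nm U_mk)/d²` — the only surviving pattern is the oriented triangle `k → n → m → k`

HONEST FRAMING: exact (Metropolis-corrected) sampling algorithms for lattice gauge theory;
figures of merit are autocorrelation/cost numbers at stated couplings and volumes; no
continuum-physics claim.

Venture `LatticeQCDFlow` (cell pub-lqcd), topic `Exactness`; FANOUT row 7 (`s0-cpn-null`).  NEW WORK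
of the cell over the tree's `Exactness/SphereLatticeMoments.lean` (GEN-11: a functional affine in
one site variable has mean zero; rank-one quadratic site dependence `d·∫F = ∫⟪a, b⟫`),
`Exactness/SphereActionVariance.lean` (GEN-11: `∫⟪V x_m, W x_m'⟫ dπ̄ = [m = m']·Σ_i⟪V b_i, W b_i⟫/d`),
`Exactness/SphereLuscherConstantsParity.lean` (GEN-12: the sublattice flip preserves `π̄`),
`Exactness/SphereLOFlowAction.lean` (`localField`, `localField_update_self`, `localField_add/_single`)
and `Exactness/SphereLatticeGreen.lean` (`contDiff_update_prod`); nothing is cited as a fact.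
Printed counterpart, NAMED ONLY: M. Lüscher, Commun. Math. Phys. 293 (2010) 899, §4.2 (the
constants of the flow-action series are the cumulants of the action); Engel–Schaefer, Comput. Phys.
Commun. 182 (2011) 2107, §2 eqs. (6)–(7) (the action `−κ Σ_n ⟪x_n, J_n⟫ + S₀`, `J_n = Σ_m U_nm x_m`).
This file is the third-order companion of the second-order sums of `SphereActionVariance` §2, on
the way to the third cumulant of the action and Lüscher's NNLO constant `ċ₂`
(`Exactness/SphereActionThirdMoment.lean`).

## Setting

`d = dim E ≥ 2`, `Λ` finite, `π̄ = ⊗_Λ σ̄`; couplings `U : Λ → Λ → (E →L[ℝ] E)` with no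
self-coupling (`U_nn = 0`); `b = stdOrthonormalBasis ℝ E`; the TRIANGLE TRACE of an ordered triple
`(k, n, m)` is `Σ_i ⟪U_kn U_nm b_i, U_km b_i⟫ = tr(U_kmᵀ U_kn U_nm)` (`= tr(U_mk U_kn U_nm)`, the
trace of the transport around `k → m → n → k`, for adjoint pairs `U_mk = U_kmᵀ`).

## Content

* §1 **`integral_eq_zero_of_site_odd`** — a functional that is ODD in one site variable
  (`F(x[k ← −y]) = −F(x[k ← y])`) integrates to zero (the flip `ω_k ↦ −ω_k` preserves `π̄`);
  `integral_inner_localField_pow_three` (`∫⟪J_k, x_k⟫³ dπ̄ = 0`).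
* §2 `localField_update_eq` (`J_k(x[n ← y]) = J_k(x[n ← 0]) + U_kn y`), the three pieces of
  `⟪x_n, U_nm x_m⟫·‖J_k‖²` after expanding `J_k` in the site variable `x_n`, and
  **`integral_link_mul_norm_sq_localField`**: for ALL `k, n, m`,
  `∫ ⟪x_n, U_nm x_m⟫·‖J_k x‖² dπ̄ = 2·(Σ_i ⟪U_kn U_nm b_i, U_km b_i⟫)/d²` — the piece constant in
  `x_n` is affine in `x_n` (mean zero), the piece quadratic in `x_n` is odd (mean zero), the cross
  piece is rank-one quadratic and collapses onto `⟪U_kn U_nm x_m, J_k(x[n ← 0])⟫/d`, of which only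
  the `m`-term of `J_k` survives; the degenerate triples (`n = m`, `n = k`, `m = k`) vanish on both
  sides because `U_nn = 0`.
* §3 **`integral_esAction_sub_mul_norm_sq_localField`** — summing over the links:
  `∫ (S − S₀)·‖J_k‖² dπ̄ = −(2κ/d²)·Σ_n Σ_m Σ_i ⟪U_kn U_nm b_i, U_km b_i⟫` for the E–S action
  `S = esAction κ S₀ U`.

NOT CLAIMED: fourth and higher lattice sums; anything at flow time `t > 0`; the rung's numbers.
-/

noncomputable section

namespace Summit.Ventures.LatticeQCDFlow.Exactness

open Function Set Metric MeasureTheory NormedSpace InnerProductSpace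
open scoped RealInnerProductSpace

variable {Λ : Type*} {E : Type*} [NormedAddCommGroup E] [InnerProductSpace ℝ E]
  [FiniteDimensional ℝ E] [MeasurableSpace E] [BorelSpace E] [Fintype Λ] [DecidableEq Λ] [Nontrivial E]

/-! ## §1 Site-odd functionals have mean zero -/

section Odd

/-- **A functional that is odd in the site variable `x_k` integrates to zero under `π̄`**: if
`F(x[k ← −y]) = −F(x[k ← y])` for all `x`, `y`, then `∫F dπ̄ = 0` (the flip `ω_k ↦ −ω_k` of the
single site `k` preserves `π̄` — `measurePreserving_sublatticeFlip` with `A = {k}` — and reverses the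
sign of the integrand).  No regularity of `F` is needed. -/
theorem integral_eq_zero_of_site_odd {F : (Λ → E) → ℝ} (k : Λ)
    (hodd : ∀ x y, F (update x k (-y)) = -F (update x k y)) :
    ∫ ω, F (fun n => ((ω : Λ → sphere (0 : E) 1) n : E))
        ∂Measure.pi (fun _ : Λ => uniformSphere (volume : Measure E)) = 0 := by
  classical
  have hΦ := measurePreserving_sublatticeFlip (E := E) ({k} : Set Λ)
  have hinv := sublatticeFlip_involutive (E := E) ({k} : Set Λ)
  have hemb : MeasurableEmbedding
      (fun (ω : Λ → sphere (0 : E) 1) (n : Λ) => if n ∈ ({k} : Set Λ) then -ω n else ω n) :=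
    (MeasurableEquiv.ofInvolutive _ hinv hΦ.measurable).measurableEmbedding
  have hcomp := hΦ.integral_comp hemb (fun ω : Λ → sphere (0 : E) 1 => F (fun n => (ω n : E)))
  have hflip : ∀ ω : Λ → sphere (0 : E) 1,
      F (fun m => (((fun n => if n ∈ ({k} : Set Λ) then -ω n else ω n) m : sphere (0 : E) 1) : E)) =
        -F (fun m => (ω m : E)) := fun ω => by
    have hcoe : (fun m => (((fun n => if n ∈ ({k} : Set Λ) then -ω n else ω n) m :
        sphere (0 : E) 1) : E)) = update (fun m => (ω m : E)) k (-(ω k : E)) := by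
      funext m
      by_cases hm : m = k
      · subst hm; simp
      · simp [hm]
    rw [hcoe, hodd, update_eq_self]
  simp_rw [hflip, integral_neg] at hcomp
  linarith

variable {U : Λ → Λ → (E →L[ℝ] E)}

/-- **`∫ ⟪J_k, x_k⟫³ dπ̄ = 0`** (no self-coupling: `J_k` does not see `x_k`, so the integrand is odd
in `x_k`). -/
theorem integral_inner_localField_pow_three (hU0 : ∀ n, U n n = 0) (k : Λ) :
    ∫ ω, ⟪localField U k (fun n => ((ω : Λ → sphere (0 : E) 1) n : E)), ((ω k : sphere (0 : E) 1) : E)⟫ ^ 3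
        ∂Measure.pi (fun _ : Λ => uniformSphere (volume : Measure E)) = 0 := by
  have h := integral_eq_zero_of_site_odd (Λ := Λ) (E := E)
    (F := fun x : Λ → E => ⟪localField U k x, x k⟫ ^ 3) k fun x y => by
      simp only [localField_update_self hU0, update_self, inner_neg_right]
      ring
  exact h

end Odd

/-! ## §2 The third-order link sum `∫⟪x_n, U_nm x_m⟫·‖J_k‖² dπ̄` -/

section Link

variable {U : Λ → Λ → (E →L[ℝ] E)}

omit [FiniteDimensional ℝ E] [MeasurableSpace E] [BorelSpace E] [Nontrivial E] in
/-- Expanding the local field in one site variable: `J_k(x[n ← y]) = J_k(x[n ← 0]) + U_kn y`. -/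
theorem localField_update_eq (k n : Λ) (x : Λ → E) (y : E) :
    localField U k (update x n y) = localField U k (update x n 0) + U k n y := by
  rw [update_eq_update_zero_add_single x n y, localField_add, localField_single]

omit [FiniteDimensional ℝ E] [MeasurableSpace E] [BorelSpace E] [Nontrivial E] in
/-- In particular `J_k(x) = J_k(x[n ← 0]) + U_kn x_n`. -/
theorem localField_eq_update_zero_add (k n : Λ) (x : Λ → E) :
    localField U k x = localField U k (update x n 0) + U k n (x n) := by
  conv_lhs => rw [← update_eq_self n x]
  exact localField_update_eq k n x (x n)

omit [FiniteDimensional ℝ E] [MeasurableSpace E] [BorelSpace E] [Nontrivial E] in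
/-- `x ↦ J_k(x[n ← 0])` is smooth. -/
theorem contDiff_localField_update_zero (k n : Λ) {r : WithTop ℕ∞} :
    ContDiff ℝ r (fun x : Λ → E => localField U k (update x n 0)) :=
  (contDiff_localField U k).comp
    ((contDiff_update_prod n).comp (contDiff_id.prodMk contDiff_const))

/-- **THE THIRD-ORDER LINK SUM.**  For all sites `k, n, m` (no self-coupling, `d ≥ 2`):
`∫ ⟪x_n, U_nm x_m⟫·‖J_k x‖² dπ̄ = 2·(Σ_i ⟪U_kn U_nm b_i, U_km b_i⟫)/d²`.  Generic case: expand
`J_k = J_k(x[n ← 0]) + U_kn x_n`; the `‖J_k(x[n←0])‖²` piece is affine in `x_n`, the `‖U_kn x_n‖²`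
piece is odd in `x_n`, the cross piece is rank-one quadratic in `x_n` and integrates to
`(2/d)·∫⟪U_kn U_nm x_m, J_k(x[n ← 0])⟫`, whose only surviving term is `l = m`:
`Σ_i⟪U_kn U_nm b_i, U_km b_i⟫/d`.  Degenerate triples vanish on both sides (`U_nn = 0`). -/
theorem integral_link_mul_norm_sq_localField (h2 : 2 ≤ Module.finrank ℝ E) (hU0 : ∀ n, U n n = 0)
    (k n m : Λ) :
    ∫ ω, ⟪((ω : Λ → sphere (0 : E) 1) n : E), U n m ((ω m : E))⟫ *
        ‖localField U k (fun l => (ω l : E))‖ ^ 2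
          ∂Measure.pi (fun _ : Λ => uniformSphere (volume : Measure E)) =
      2 * (∑ i, ⟪U k n (U n m (stdOrthonormalBasis ℝ E i)), U k m (stdOrthonormalBasis ℝ E i)⟫) /
        (Module.finrank ℝ E : ℝ) ^ 2 := by
  set B := stdOrthonormalBasis ℝ E with hB
  have hd : (0 : ℝ) < (Module.finrank ℝ E : ℝ) := by exact_mod_cast Module.finrank_pos
  -- degenerate triples
  by_cases hnm : n = m
  · subst hnm
    simp [hU0]
  by_cases hnk : n = k
  · subst hnk
    have hF : ContDiff ℝ 2 (fun x : Λ → E => ⟪x n, U n m (x m)⟫ * ‖localField U n x‖ ^ 2) :=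
      ((contDiff_apply ℝ E n).inner ℝ ((U n m).contDiff.comp (contDiff_apply ℝ E m))).mul
        ((contDiff_localField U n).norm_sq ℝ)
    have h0 := integral_eq_zero_of_site_affine (Λ := Λ) h2 hF n
      (fun x => ‖localField U n x‖ ^ 2 • U n m (x m)) fun x y => by
        simp only [update_self, update_of_ne (Ne.symm hnm), localField_update_self hU0,
          real_inner_smul_left, real_inner_comm (U n m (x m))]
        ring
    rw [h0]
    simp [hU0]
  by_cases hmk : m = k
  · subst hmk
    have hF : ContDiff ℝ 2 (fun x : Λ → E => ⟪x n, U n m (x m)⟫ * ‖localField U m x‖ ^ 2) :=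
      ((contDiff_apply ℝ E n).inner ℝ ((U n m).contDiff.comp (contDiff_apply ℝ E m))).mul
        ((contDiff_localField U m).norm_sq ℝ)
    have h0 := integral_eq_zero_of_site_affine (Λ := Λ) h2 hF m
      (fun x => ‖localField U m x‖ ^ 2 • ContinuousLinearMap.adjoint (U n m) (x n)) fun x y => by
        simp only [update_self, update_of_ne hnm, localField_update_self hU0,
          real_inner_smul_left, ContinuousLinearMap.adjoint_inner_left]
        ring
    rw [h0]
    simp [hU0]
  -- generic case: `n ≠ m`, `n ≠ k`, `m ≠ k`
  set J' : (Λ → E) → E := fun x => localField U k (update x n 0) with hJ'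
  have hJ'c : ContDiff ℝ 2 J' := contDiff_localField_update_zero k n
  have hJ'u : ∀ x y, J' (update x n y) = J' x := fun x y => by
    simp only [hJ', update_idem]
  -- the three pieces
  set F₁ : (Λ → E) → ℝ := fun x => ⟪x n, U n m (x m)⟫ * ‖J' x‖ ^ 2 with hF₁
  set F₂ : (Λ → E) → ℝ := fun x => ⟪x n, U n m (x m)⟫ * (2 * ⟪J' x, U k n (x n)⟫) with hF₂
  set F₃ : (Λ → E) → ℝ := fun x => ⟪x n, U n m (x m)⟫ * ‖U k n (x n)‖ ^ 2 with hF₃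
  have hsplit : ∀ ω : Λ → sphere (0 : E) 1,
      ⟪((ω n : sphere (0 : E) 1) : E), U n m ((ω m : E))⟫ * ‖localField U k (fun l => (ω l : E))‖ ^ 2 =
        F₁ (fun l => (ω l : E)) + F₂ (fun l => (ω l : E)) + F₃ (fun l => (ω l : E)) := fun ω => by
    rw [localField_eq_update_zero_add k n (fun l => ((ω l : sphere (0 : E) 1) : E)), norm_add_sq_real]
    simp only [hF₁, hF₂, hF₃, hJ']
    ring
  have hlin : ContDiff ℝ 2 (fun x : Λ → E => ⟪x n, U n m (x m)⟫) :=
    (contDiff_apply ℝ E n).inner ℝ ((U n m).contDiff.comp (contDiff_apply ℝ E m))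
  have hF₁c : ContDiff ℝ 2 F₁ := hlin.mul (hJ'c.norm_sq ℝ)
  have hF₂c : ContDiff ℝ 2 F₂ :=
    hlin.mul (contDiff_const.mul (hJ'c.inner ℝ ((U k n).contDiff.comp (contDiff_apply ℝ E n))))
  have hF₃c : ContDiff ℝ 2 F₃ :=
    hlin.mul (((U k n).contDiff.comp (contDiff_apply ℝ E n)).norm_sq ℝ)
  -- (1) the piece constant in the expansion is affine in `x_n`
  have h1 : ∫ ω, F₁ (fun l => ((ω : Λ → sphere (0 : E) 1) l : E))
      ∂Measure.pi (fun _ : Λ => uniformSphere (volume : Measure E)) = 0 :=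
    integral_eq_zero_of_site_affine (Λ := Λ) h2 hF₁c n (fun x => ‖J' x‖ ^ 2 • U n m (x m))
      fun x y => by
        simp only [hF₁, hJ'u, update_self, update_of_ne (Ne.symm hnm), real_inner_smul_left,
          real_inner_comm (U n m (x m))]
        ring
  -- (3) the piece quadratic in `U_kn x_n` is odd in `x_n`
  have h3 : ∫ ω, F₃ (fun l => ((ω : Λ → sphere (0 : E) 1) l : E))
      ∂Measure.pi (fun _ : Λ => uniformSphere (volume : Measure E)) = 0 :=
    integral_eq_zero_of_site_odd (Λ := Λ) n fun x y => by
      simp only [hF₃, update_self, update_of_ne (Ne.symm hnm), map_neg, norm_neg, inner_neg_left]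
      ring
  -- (2) the cross piece is rank-one quadratic in `x_n`
  have h2' : (Module.finrank ℝ E : ℝ) * ∫ ω, F₂ (fun l => ((ω : Λ → sphere (0 : E) 1) l : E))
      ∂Measure.pi (fun _ : Λ => uniformSphere (volume : Measure E)) =
      ∫ ω, ⟪U n m (((ω : Λ → sphere (0 : E) 1) m : E)),
        (2 : ℝ) • ContinuousLinearMap.adjoint (U k n) (J' (fun l => (ω l : E)))⟫
          ∂Measure.pi (fun _ : Λ => uniformSphere (volume : Measure E)) :=
    integral_site_quadratic (Λ := Λ) hF₂c n (fun x => U n m (x m))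
      (fun x => (2 : ℝ) • ContinuousLinearMap.adjoint (U k n) (J' x))
      ((U n m).continuous.comp (continuous_apply m))
      ((ContinuousLinearMap.adjoint (U k n)).continuous.comp hJ'c.continuous |>.const_smul _)
      fun x y => by
        simp only [hF₂, hJ'u, update_self, update_of_ne (Ne.symm hnm), real_inner_smul_left,
          ContinuousLinearMap.adjoint_inner_left, real_inner_comm (U n m (x m))]
  -- … and its value: only the `m`-term of `J_k(x[n ← 0])` pairs with `x_m`
  have hval : ∫ ω, ⟪U n m (((ω : Λ → sphere (0 : E) 1) m : E)),
        (2 : ℝ) • ContinuousLinearMap.adjoint (U k n) (J' (fun l => (ω l : E)))⟫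
          ∂Measure.pi (fun _ : Λ => uniformSphere (volume : Measure E)) =
      2 * (∑ i, ⟪U k n (U n m (B i)), U k m (B i)⟫) / (Module.finrank ℝ E : ℝ) := by
    have hpt : ∀ ω : Λ → sphere (0 : E) 1,
        ⟪U n m ((ω m : E)), (2 : ℝ) • ContinuousLinearMap.adjoint (U k n) (J' (fun l => (ω l : E)))⟫ =
          2 * ∑ l, ⟪((U k n).comp (U n m)) ((ω m : E)),
            U k l (update (fun l' => ((ω l' : sphere (0 : E) 1) : E)) n 0 l)⟫ := fun ω => by
      simp only [real_inner_smul_right, ContinuousLinearMap.adjoint_inner_right, hJ', localField,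
        inner_sum, ContinuousLinearMap.coe_comp, Function.comp_apply]
    simp_rw [hpt]
    have hc : ∀ l, Continuous fun ω : Λ → sphere (0 : E) 1 =>
        ⟪((U k n).comp (U n m)) ((ω m : E)),
          U k l (update (fun l' => ((ω l' : sphere (0 : E) 1) : E)) n 0 l)⟫ := fun l =>
      (((U k n).comp (U n m)).continuous.comp (continuous_subtype_val.comp (continuous_apply m))).inner
        ((U k l).continuous.comp ((continuous_apply l).comp
          (((contDiff_update_prod n (n := 0)).continuous).comp
            (continuous_sphereConfig.prodMk continuous_const))))
    have hI : ∀ l, Integrable (fun ω : Λ → sphere (0 : E) 1 =>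
        ⟪((U k n).comp (U n m)) ((ω m : E)),
          U k l (update (fun l' => ((ω l' : sphere (0 : E) 1) : E)) n 0 l)⟫)
        (Measure.pi fun _ : Λ => uniformSphere (volume : Measure E)) := fun l =>
      integrable_pi_of_continuous _ (hc l)
    rw [integral_const_mul, integral_finsetSum Finset.univ fun l _ => hI l]
    -- the `l`-th term
    have hterm : ∀ l, ∫ ω, ⟪((U k n).comp (U n m)) (((ω : Λ → sphere (0 : E) 1) m : E)),
          U k l (update (fun l' => ((ω l' : sphere (0 : E) 1) : E)) n 0 l)⟫
            ∂Measure.pi (fun _ : Λ => uniformSphere (volume : Measure E)) =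
        if m = l then (∑ i, ⟪U k n (U n m (B i)), U k m (B i)⟫) / (Module.finrank ℝ E : ℝ)
          else 0 := by
      intro l
      by_cases hln : l = n
      · subst hln
        simp only [update_self, map_zero, inner_zero_right, integral_zero, if_neg (Ne.symm hnm)]
      · simp_rw [update_of_ne hln]
        rw [integral_inner_clm_apply_clm_apply h2]
        by_cases hml : m = l
        · subst hml
          simp only [if_true, ContinuousLinearMap.coe_comp, Function.comp_apply, hB]
        · rw [if_neg hml, if_neg hml]
    simp_rw [hterm, Finset.sum_ite_eq, Finset.mem_univ, if_true]
    ring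
  -- assemble
  have hI₁ : Integrable (fun ω : Λ → sphere (0 : E) 1 => F₁ (fun l => (ω l : E)))
      (Measure.pi fun _ : Λ => uniformSphere (volume : Measure E)) :=
    integrable_pi_of_continuous _ (hF₁c.continuous.comp continuous_sphereConfig)
  have hI₂ : Integrable (fun ω : Λ → sphere (0 : E) 1 => F₂ (fun l => (ω l : E)))
      (Measure.pi fun _ : Λ => uniformSphere (volume : Measure E)) :=
    integrable_pi_of_continuous _ (hF₂c.continuous.comp continuous_sphereConfig)
  have hI₃ : Integrable (fun ω : Λ → sphere (0 : E) 1 => F₃ (fun l => (ω l : E)))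
      (Measure.pi fun _ : Λ => uniformSphere (volume : Measure E)) :=
    integrable_pi_of_continuous _ (hF₃c.continuous.comp continuous_sphereConfig)
  have hI₁₂ : Integrable (fun ω : Λ → sphere (0 : E) 1 =>
      F₁ (fun l => (ω l : E)) + F₂ (fun l => (ω l : E)))
      (Measure.pi fun _ : Λ => uniformSphere (volume : Measure E)) := hI₁.add hI₂
  simp_rw [hsplit]
  rw [integral_add hI₁₂ hI₃, integral_add hI₁ hI₂, h1, h3, zero_add, add_zero]
  have h2'' : ∫ ω, F₂ (fun l => ((ω : Λ → sphere (0 : E) 1) l : E))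
      ∂Measure.pi (fun _ : Λ => uniformSphere (volume : Measure E)) =
      2 * (∑ i, ⟪U k n (U n m (B i)), U k m (B i)⟫) / (Module.finrank ℝ E : ℝ) /
        (Module.finrank ℝ E : ℝ) := by
    rw [eq_div_iff hd.ne', mul_comm, h2', hval]
  rw [h2'', div_div, sq]

end Link

/-! ## §3 Summing over the links: `∫ (S − S₀)·‖J_k‖² dπ̄` -/

section Action

variable {U : Λ → Λ → (E →L[ℝ] E)}

/-- **`∫ (S − S₀)·‖J_k‖² dπ̄ = −(2κ/d²)·Σ_n Σ_m Σ_i ⟪U_kn U_nm b_i, U_km b_i⟫`** for the E–S action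
`S = −κ Σ_n ⟪x_n, J_n⟫ + S₀` (no self-coupling, `d ≥ 2`): the covariance of the action with the
squared local field at `k` is `−2κ/d²` times the sum of the triangle traces through `k`. -/
theorem integral_esAction_sub_mul_norm_sq_localField (h2 : 2 ≤ Module.finrank ℝ E)
    (hU0 : ∀ n, U n n = 0) (κ S₀ : ℝ) (k : Λ) :
    ∫ ω, (esAction κ S₀ U (fun l => ((ω : Λ → sphere (0 : E) 1) l : E)) - S₀) *
        ‖localField U k (fun l => (ω l : E))‖ ^ 2
          ∂Measure.pi (fun _ : Λ => uniformSphere (volume : Measure E)) =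
      -(2 * κ) / (Module.finrank ℝ E : ℝ) ^ 2 *
        ∑ n, ∑ m, ∑ i, ⟪U k n (U n m (stdOrthonormalBasis ℝ E i)),
          U k m (stdOrthonormalBasis ℝ E i)⟫ := by
  have hJ : ∀ (ω : Λ → sphere (0 : E) 1) (n : Λ),
      ⟪((ω n : sphere (0 : E) 1) : E), localField U n (fun l => (ω l : E))⟫ =
        ∑ m, ⟪((ω n : sphere (0 : E) 1) : E), U n m ((ω m : E))⟫ := fun ω n => by
    rw [localField, inner_sum]
  have hpt : ∀ ω : Λ → sphere (0 : E) 1,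
      (esAction κ S₀ U (fun l => (ω l : E)) - S₀) * ‖localField U k (fun l => (ω l : E))‖ ^ 2 =
        -κ * ∑ n, ∑ m, ⟪((ω n : sphere (0 : E) 1) : E), U n m ((ω m : E))⟫ *
          ‖localField U k (fun l => (ω l : E))‖ ^ 2 := fun ω => by
    rw [esAction_sub_const]
    simp_rw [hJ, mul_assoc, Finset.sum_mul]
  simp_rw [hpt]
  have hc : ∀ n m, Continuous fun ω : Λ → sphere (0 : E) 1 =>
      ⟪((ω n : sphere (0 : E) 1) : E), U n m ((ω m : E))⟫ *
        ‖localField U k (fun l => (ω l : E))‖ ^ 2 := fun n m =>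
    ((continuous_subtype_val.comp (continuous_apply n)).inner
      ((U n m).continuous.comp (continuous_subtype_val.comp (continuous_apply m)))).mul
      (((contDiff_localField U k (m := 0)).continuous.comp continuous_sphereConfig).norm.pow 2)
  have hI : ∀ n m, Integrable (fun ω : Λ → sphere (0 : E) 1 =>
      ⟪((ω n : sphere (0 : E) 1) : E), U n m ((ω m : E))⟫ *
        ‖localField U k (fun l => (ω l : E))‖ ^ 2)
      (Measure.pi fun _ : Λ => uniformSphere (volume : Measure E)) := fun n m =>
    integrable_pi_of_continuous _ (hc n m)
  have hI1 : ∀ n, Integrable (fun ω : Λ → sphere (0 : E) 1 =>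
      ∑ m, ⟪((ω n : sphere (0 : E) 1) : E), U n m ((ω m : E))⟫ *
        ‖localField U k (fun l => (ω l : E))‖ ^ 2)
      (Measure.pi fun _ : Λ => uniformSphere (volume : Measure E)) := fun n =>
    integrable_finsetSum Finset.univ fun m _ => hI n m
  rw [integral_const_mul, integral_finsetSum Finset.univ fun n _ => hI1 n]
  simp_rw [integral_finsetSum Finset.univ fun m _ => hI _ m,
    integral_link_mul_norm_sq_localField h2 hU0]
  rw [Finset.mul_sum, Finset.mul_sum]
  refine Finset.sum_congr rfl fun n _ => ?_
  rw [Finset.mul_sum, Finset.mul_sum]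
  refine Finset.sum_congr rfl fun m _ => ?_
  ring

end Action

end Summit.Ventures.LatticeQCDFlow.Exactness

end
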